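import Literature.NumberTheory.Transcendental.KZBetaChains
import Literature.NumberTheory.Transcendental.KZCalculusProofs

/-!
# `BetaCancellation` (stmt-KontsevichZagierPeriods-13633), line `dirichlet-companion-to-pi`: stub `stub_betaWeightSemialgebraic`

The weight of the weighted Beta cancellation, `w_{α,β}(t) = t^α (1 - t)^β` on `(0,1)` and `0`
outside (`α, β ∈ ℚ`, `0 ≤ α, β`), is admissible: as a function of the single coordinate of `ℝ¹`
it is `ℚ`-semialgebraic on all of `ℝ¹` (the Euler–Mellin monomial is `ℚ`-semialgebraic on
`{x | x 0 ∈ (0,1)}`, the zero function is `ℚ`-semialgebraic on the complement, and semialgebraic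
functions glue along a semialgebraic partition), and it is bounded by `1` (`0 ≤ t^α ≤ 1` and
`0 ≤ (1-t)^β ≤ 1` for `t ∈ (0,1)` and nonnegative exponents).

No definitions; namespace of the line skeleton.
-/

noncomputable section

set_option linter.dupNamespace false

namespace Summit.KontsevichZagierPeriods.KontsevichZagierPeriods.BetaCancellationLine

open Set
open Literature.ModelTheory.ExponentialFields (IsSemialgebraic isSemialgebraic_univ)
open Literature.NumberTheory.Transcendental
open Literature.NumberTheory.Transcendental.KZ

/-- The Euler–Mellin monomial `(x 0)^α (1 - x 0)^β` (`α, β ∈ ℚ`) is `ℚ`-semialgebraic on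
`(0,1) ⊆ ℝ¹` (the case `c = 1` of `KZ.isSemialgebraicFunOn_const_mul_rpow_mul_rpow`). [folklore] -/
theorem betaWeightSemialgebraic_isSemialgebraicFunOn_Ioo (α β : ℚ) :
    IsSemialgebraicFunOn ℚ {x : Fin 1 → ℝ | x 0 ∈ Set.Ioo (0:ℝ) 1}
      (fun x => (x 0) ^ ((α : ℚ) : ℝ) * (1 - x 0) ^ ((β : ℚ) : ℝ)) :=
  (isSemialgebraicFunOn_const_mul_rpow_mul_rpow 1 α β).congr fun x _ => by
    simp only [Rat.cast_one, one_mul]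

/-- The zero function is `ℚ`-semialgebraic on the complement `{x | x 0 ∉ (0,1)} ⊆ ℝ¹` of the open
unit interval (a polynomial on a semialgebraic set). [folklore] -/
theorem betaWeightSemialgebraic_isSemialgebraicFunOn_zero_compl :
    IsSemialgebraicFunOn ℚ ({x : Fin 1 → ℝ | x 0 ∈ Set.Ioo (0:ℝ) 1}ᶜ) (fun _ => (0 : ℝ)) :=
  (isSemialgebraicFunOn_aeval BallPeeling.isSemialgebraic_posIoo.compl 0).congr fun x _ => by
    simp only [map_zero]

/-- The weight `x ↦ w_{α,β}(x 0)` (`t^α (1-t)^β` on `(0,1)`, `0` outside) is `ℚ`-semialgebraic on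
`ℝ¹`: glue the monomial on `{x | x 0 ∈ (0,1)}` with `0` on the complement. [folklore] -/
theorem betaWeightSemialgebraic_isSemialgebraicFunOn (α β : ℚ) :
    IsSemialgebraicFunOn ℚ (Set.univ : Set (Fin 1 → ℝ))
      (fun x => if x 0 ∈ Set.Ioo (0:ℝ) 1 then (x 0) ^ ((α : ℚ) : ℝ) * (1 - x 0) ^ ((β : ℚ) : ℝ)
        else 0) := by
  rw [← Set.union_compl_self {x : Fin 1 → ℝ | x 0 ∈ Set.Ioo (0:ℝ) 1}]
  refine (betaWeightSemialgebraic_isSemialgebraicFunOn_Ioo α β).union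
    betaWeightSemialgebraic_isSemialgebraicFunOn_zero_compl (fun x hx => ?_) (fun x hx => ?_)
  · have hx' : x 0 ∈ Set.Ioo (0:ℝ) 1 := hx
    simp only [hx', if_true]
  · have hx' : x 0 ∉ Set.Ioo (0:ℝ) 1 := hx
    simp only [hx', if_false]

/-- For `t ∈ (0,1)` and rational `0 ≤ α, β`, the monomial `t^α (1-t)^β` lies in `[0,1]`.
[folklore] -/
theorem betaWeightSemialgebraic_monomial_mem_Icc {α β : ℚ} (hα : 0 ≤ α) (hβ : 0 ≤ β) {t : ℝ}
    (ht : t ∈ Set.Ioo (0:ℝ) 1) :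
    0 ≤ t ^ ((α : ℚ) : ℝ) * (1 - t) ^ ((β : ℚ) : ℝ) ∧
      t ^ ((α : ℚ) : ℝ) * (1 - t) ^ ((β : ℚ) : ℝ) ≤ 1 := by
  have hα' : (0:ℝ) ≤ ((α : ℚ) : ℝ) := Rat.cast_nonneg.mpr hα
  have hβ' : (0:ℝ) ≤ ((β : ℚ) : ℝ) := Rat.cast_nonneg.mpr hβ
  have ht0 : 0 ≤ t := ht.1.le
  have ht1 : t ≤ 1 := ht.2.le
  have hs0 : 0 ≤ 1 - t := sub_nonneg.mpr ht1
  have hs1 : 1 - t ≤ 1 := sub_le_self 1 ht0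
  exact ⟨mul_nonneg (Real.rpow_nonneg ht0 _) (Real.rpow_nonneg hs0 _),
    mul_le_one₀ (Real.rpow_le_one ht0 ht1 hα') (Real.rpow_nonneg hs0 _)
      (Real.rpow_le_one hs0 hs1 hβ')⟩

/-- The weight `w_{α,β}` (`t^α (1-t)^β` on `(0,1)`, `0` outside; `0 ≤ α, β ∈ ℚ`) is bounded by `1`
in absolute value. [folklore] -/
theorem betaWeightSemialgebraic_abs_le {α β : ℚ} (hα : 0 ≤ α) (hβ : 0 ≤ β) (t : ℝ) :
    |(if t ∈ Set.Ioo (0:ℝ) 1 then t ^ ((α : ℚ) : ℝ) * (1 - t) ^ ((β : ℚ) : ℝ) else 0)| ≤ 1 := by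
  split_ifs with ht
  · obtain ⟨h0, h1⟩ := betaWeightSemialgebraic_monomial_mem_Icc hα hβ ht
    rw [abs_of_nonneg h0]
    exact h1
  · simp only [abs_zero, zero_le_one]

/-- **The Beta weight is admissible**: for rational `0 ≤ α, β`, the weight `w_{α,β}` (`t^α (1-t)^β`
on `(0,1)`, `0` outside), read as a function of the single coordinate of `ℝ¹`, is
`ℚ`-semialgebraic on `ℝ¹` and bounded by `1`. [folklore] -/
theorem stub_betaWeightSemialgebraic :
    ∀ (α β : ℚ), 0 ≤ α → 0 ≤ β →
    IsSemialgebraicFunOn ℚ (Set.univ : Set (Fin 1 → ℝ))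
      (fun x => if x 0 ∈ Set.Ioo (0:ℝ) 1 then (x 0) ^ ((α : ℚ) : ℝ) * (1 - x 0) ^ ((β : ℚ) : ℝ) else 0) ∧
    ∀ t : ℝ, |(if t ∈ Set.Ioo (0:ℝ) 1 then t ^ ((α : ℚ) : ℝ) * (1 - t) ^ ((β : ℚ) : ℝ) else 0)| ≤ 1 :=
  fun α β hα hβ =>
    ⟨betaWeightSemialgebraic_isSemialgebraicFunOn α β, betaWeightSemialgebraic_abs_le hα hβ⟩

end Summit.KontsevichZagierPeriods.KontsevichZagierPeriods.BetaCancellationLine
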